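import Summits.Ventures.PercRepro.RankLevelSetHallLostBin

/-!
# PercRepro — RULE BIN PAYS EVERY ISOLATED LOST SET: THE SINGLE-FLAT THEOREM (p4, gen 33; C-044, UP form; paper
proofs/P4-CELL-THREE.md §14.20 (h))

A lost set `S` is **isolated** when every lost set disjoint from its flat part `cl S ∖ S` lies inside `S` — the situation
of the model `T_p(F ⊕ free)` with a uniform or paving flat `F`, where `cl S` is the only fat flat around `S`.  THEOREM: at
the tight layer every isolated lost set receives at least `1` under Rule BIN.  PROOF: with `#S = q + j` (`1 ≤ j ≤ k − 1`),
`D := E ∖ cl S` has at least `k` points (`#cl S ≤ 2q`: the part of `cl S` outside a member inside `S` is independent of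
rank `≤ q`); fix `D₀ ⊆ D` with `k − 1` points and `J₀ ⊆ D₀` with `j` points; for every proper subset `X ⊊ J₀` the set
`T_X := S ∪ (D₀ ∖ X)` is a big `Y`-set (size `q + j + (k − 1 − #X) ≥ p`, rank `> q` because `D₀ ∖ X ≠ ∅` avoids `cl S`,
rank `≤ q + k − 1 < p`), the `2^j − 1` sets `T_X` are distinct, and the lost subsets of `T_X` avoid `cl S ∖ S`, hence lie
inside `S` by isolation: `B(T_X) ≤ Σ_{q < #X' ≤ q + j} C(q+j, #X')·C(#X', q) = C(q+j, q)·(2^j − 1)`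
(`sum_choose_mul_choose_gt`, through `Nat.choose_mul`).  So `S` receives at least `(2^j − 1)·C(q+j,q)/(C(q+j,q)(2^j − 1)) = 1`.
(The full family `W ⊆ D`, `k − j ≤ #W ≤ k − 1`, gives receipt `≥ 2` — the model's value; paper.)
* `sum_choose_mul_choose_gt` — the binomial identity;
* `IsolatedLost`, `lostMass_le_of_isolated`;
* **`one_le_lostBinRecv_of_isolated`** — an isolated lost set receives at least `1`;
* `lostBin_of_forall_isolated`, `hallUp_of_ncard_eq_of_forall_isolated`.
Axioms: standard.
-/

namespace PercRepro

open Set Matroid Finset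

/-- `Σ_{m ≤ n} C(n, m)·C(m, q)·[q < m] = C(n, q)·(2^{n−q} − 1)` for `q ≤ n`. -/
lemma sum_choose_mul_choose_gt (n q : ℕ) (hq : q ≤ n) :
    ∑ m ∈ range (n + 1), (if q < m then ((n.choose m * m.choose q : ℕ) : ℚ) else 0)
      = (n.choose q : ℚ) * ((2 : ℚ) ^ (n - q) - 1) := by
  obtain ⟨j, rfl⟩ := Nat.exists_eq_add_of_le hq
  have hterm : ∀ m ∈ range (q + j + 1), (if q < m then (((q + j).choose m * m.choose q : ℕ) : ℚ) else 0)
      = ((q + j).choose q : ℚ) * (if q < m then (j.choose (m - q) : ℚ) else 0) := by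
    intro m _
    by_cases hm : q < m
    · rw [if_pos hm, if_pos hm, Nat.choose_mul hm.le, show q + j - q = j by omega]
      push_cast
      ring
    · rw [if_neg hm, if_neg hm, mul_zero]
  rw [Finset.sum_congr rfl hterm, ← Finset.mul_sum, show q + j + 1 = q + (j + 1) by ring, Finset.sum_range_add]
  have h0 : ∑ m ∈ range q, (if q < m then (j.choose (m - q) : ℚ) else 0) = 0 := by
    refine Finset.sum_eq_zero (fun m hm => ?_)
    rw [Finset.mem_range] at hm
    rw [if_neg (by omega)]
  rw [h0, zero_add, Finset.sum_range_succ']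
  simp only [add_tsub_cancel_left, lt_self_iff_false, if_false, add_zero]
  have h1 : ∑ i ∈ range j, (if q < q + (i + 1) then (j.choose (i + 1) : ℚ) else 0)
      = ∑ i ∈ range j, (j.choose (i + 1) : ℚ) := by
    refine Finset.sum_congr rfl (fun i _ => ?_)
    rw [if_pos (by omega)]
  rw [h1]
  congr 1
  have h2 : ∑ i ∈ range (j + 1), (j.choose i : ℚ) = 2 ^ j := by
    exact_mod_cast Nat.sum_range_choose j
  rw [Finset.sum_range_succ'] at h2
  simp only [Nat.choose_zero_right, Nat.cast_one] at h2
  linarith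

variable {α : Type} (M : Matroid α) [M.Finite]

/-- A lost set `S` is **isolated** when every lost set disjoint from its flat part `cl S ∖ S` lies inside `S`. -/
def IsolatedLost (p q : ℕ) (S : Set α) : Prop :=
  ∀ S' ∈ lostSets M p q, Disjoint S' (M.closure S \ S) → S' ⊆ S

/-- **The LYM mass of a big set through an isolated lost set whose extra points avoid the closure** is at most
`C(#S, q)·(2^{#S − q} − 1)`: its lost subsets lie inside `S`. -/
theorem lostMass_le_of_isolated (p q : ℕ) {S : Set α} (hS : S ∈ lostSets M p q) (hiso : IsolatedLost M p q S)
    {W : Set α} (hW : Disjoint W (M.closure S)) :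
    lostMass M p q (S ∪ W) ≤ (S.ncard.choose q : ℚ) * ((2 : ℚ) ^ (S.ncard - q) - 1) := by
  classical
  obtain ⟨hSE, hqS, hSq, hSp, -⟩ := hS
  have hEfin : M.E.Finite := M.ground_finite
  have hSfin : S.Finite := hEfin.subset hSE
  set Sf : Finset α := hSfin.toFinset with hSf
  have hSfcard : Sf.card = S.ncard := by rw [hSf, ← ncard_eq_toFinset_card _ hSfin]
  set Lf : Finset (Set α) := (lostSets_finite M p q).toFinset with hLf
  have hmemL : ∀ S', S' ∈ Lf ↔ S' ∈ lostSets M p q := fun S' => by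
    rw [hLf, (lostSets_finite M p q).mem_toFinset]
  -- the lost subsets of `S ∪ W` lie inside `S`
  have hsub : ∀ S' ∈ lostSets M p q, S' ⊆ S ∪ W → S' ⊆ S := by
    intro S' hS' hS'T
    refine hiso S' hS' ?_
    refine Set.disjoint_left.2 (fun x hxS' hxP => ?_)
    rcases hS'T hxS' with hxS | hxW
    · exact hxP.2 hxS
    · exact Set.disjoint_left.1 hW hxW hxP.1
  -- step 1: the mass of `S ∪ W` is at most the mass of the lost subsets of `S`
  have h1 : lostMass M p q (S ∪ W) ≤ ∑ S' ∈ Lf, (if S' ⊆ S then ((S'.ncard.choose q : ℕ) : ℚ) else 0) := by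
    unfold lostMass
    refine Finset.sum_le_sum (fun S' hS' => ?_)
    rw [hmemL] at hS'
    by_cases hS'T : S' ⊆ S ∪ W
    · rw [if_pos hS'T, if_pos (hsub S' hS' hS'T)]
    · rw [if_neg hS'T]
      split_ifs <;> positivity
  -- step 2: the lost subsets of `S` are among the subsets of `S` with more than `q` elements
  set Pw : Finset (Finset α) := Sf.powerset.filter (fun X => q < X.card) with hPw
  have h2 : ∑ S' ∈ Lf, (if S' ⊆ S then ((S'.ncard.choose q : ℕ) : ℚ) else 0)
      ≤ ∑ X ∈ Pw, ((X.card.choose q : ℕ) : ℚ) := by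
    rw [← Finset.sum_filter]
    have himg : ∑ X ∈ Pw, ((X.card.choose q : ℕ) : ℚ)
        = ∑ S' ∈ Pw.image (fun X : Finset α => (X : Set α)), ((S'.ncard.choose q : ℕ) : ℚ) := by
      rw [Finset.sum_image (fun X _ Y _ h => Finset.coe_injective h)]
      refine Finset.sum_congr rfl (fun X _ => ?_)
      rw [Set.ncard_coe_finset]
    rw [himg]
    refine Finset.sum_le_sum_of_subset_of_nonneg ?_ (fun _ _ _ => by positivity)
    intro S' hS'
    rw [Finset.mem_filter, hmemL] at hS'
    obtain ⟨hS'l, hS'S⟩ := hS'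
    have hS'fin : S'.Finite := hSfin.subset hS'S
    rw [Finset.mem_image]
    refine ⟨hS'fin.toFinset, ?_, by simp⟩
    rw [hPw, Finset.mem_filter, Finset.mem_powerset]
    refine ⟨?_, ?_⟩
    · intro x hx
      rw [hS'fin.mem_toFinset] at hx
      rw [hSf, hSfin.mem_toFinset]
      exact hS'S hx
    · rw [← ncard_eq_toFinset_card _ hS'fin]
      exact hS'l.2.2.1
  -- step 3: the binomial identity
  have h3 : ∑ X ∈ Pw, ((X.card.choose q : ℕ) : ℚ)
      = (S.ncard.choose q : ℚ) * ((2 : ℚ) ^ (S.ncard - q) - 1) := by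
    rw [hPw, Finset.sum_filter, Finset.sum_powerset_apply_card (fun m => if q < m then ((m.choose q : ℕ) : ℚ) else 0),
      hSfcard, ← sum_choose_mul_choose_gt S.ncard q hSq.le]
    refine Finset.sum_congr rfl (fun m _ => ?_)
    rw [nsmul_eq_mul]
    by_cases hm : q < m
    · rw [if_pos hm, if_pos hm]
      push_cast
      ring
    · rw [if_neg hm, if_neg hm, mul_zero]
  calc lostMass M p q (S ∪ W) ≤ _ := h1
    _ ≤ _ := h2
    _ = _ := h3

/-- **Rule BIN pays every isolated lost set** (tight layer): an isolated lost set receives at least `1`. -/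
theorem one_le_lostBinRecv_of_isolated (p q : ℕ) (hE : M.E.ncard = p + q) (hpq : q < p) {S : Set α}
    (hS : S ∈ lostSets M p q) (hiso : IsolatedLost M p q S) : 1 ≤ lostBinRecv M p q S := by
  classical
  obtain ⟨hSE, hqS, hSq, hSp, Z, hZ, hZS⟩ := hS
  have hSlost : S ∈ lostSets M p q := ⟨hSE, hqS, hSq, hSp, Z, hZ, hZS⟩
  have hEfin : M.E.Finite := M.ground_finite
  have hSfin : S.Finite := hEfin.subset hSE
  -- the sizes
  obtain ⟨j, hj⟩ : ∃ j, S.ncard = q + j := Nat.exists_eq_add_of_le hSq.le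
  have hj1 : 1 ≤ j := by omega
  set k := p - q with hk
  have hpk : p = q + k := by omega
  have hjk : j + 1 ≤ k := by omega
  -- the closure of `S` has at most `2q` points
  have hclE : M.closure S ⊆ M.E := M.closure_subset_ground S
  have hclfin : (M.closure S).Finite := hEfin.subset hclE
  have hZcard : Z.ncard = q := ncard_eq_q_of_mem_cellMembers_tight M hE hZ
  have hclcard : (M.closure S).ncard ≤ 2 * q := by
    have hsplit := Set.ncard_inter_add_ncard_sdiff_eq_ncard (M.closure S) Z hclfin
    have hA : (M.closure S ∩ Z).ncard ≤ q := by
      rw [← hZcard]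
      exact Set.ncard_le_ncard Set.inter_subset_right (hEfin.subset hZ.1)
    have hB : (M.closure S \ Z).ncard ≤ q := by
      have hind : M.Indep (M.closure S \ Z) :=
        (compl_indep_of_mem_U M hE hZ).1.subset (fun x hx => ⟨hclE hx.1, hx.2⟩)
      have h1 : M.eRk (M.closure S \ Z) = ((M.closure S \ Z).ncard : ℕ∞) := by
        rw [hind.eRk_eq_encard, (hclfin.subset Set.sdiff_subset).cast_ncard_eq]
      have h2 : M.eRk (M.closure S \ Z) ≤ M.eRk (M.closure S) := M.eRk_mono Set.sdiff_subset
      rw [h1, M.eRk_closure_eq, hqS] at h2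
      exact_mod_cast h2
    omega
  -- the free part `D = E ∖ cl S` has at least `k` points
  set D : Set α := M.E \ M.closure S with hD
  have hDfin : D.Finite := hEfin.subset Set.sdiff_subset
  have hDcard : k ≤ D.ncard := by
    rw [hD, Set.ncard_sdiff' hclE hEfin, hE]
    omega
  set Df : Finset α := hDfin.toFinset with hDf
  have hDfcard : Df.card = D.ncard := by rw [hDf, ← ncard_eq_toFinset_card _ hDfin]
  have hDfD : ∀ x ∈ Df, x ∈ D := fun x hx => by rwa [hDf, hDfin.mem_toFinset] at hx
  -- `D₀ ⊆ D` with `k − 1` points, `J₀ ⊆ D₀` with `j` points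
  obtain ⟨D₀, hD₀D, hD₀card⟩ := Finset.exists_subset_card_eq (show k - 1 ≤ Df.card by omega)
  obtain ⟨J₀, hJ₀D₀, hJ₀card⟩ := Finset.exists_subset_card_eq (show j ≤ D₀.card by omega)
  -- the index family: the proper subsets of `J₀`
  set 𝒳 : Finset (Finset α) := J₀.powerset.erase J₀ with h𝒳
  have h𝒳card : 𝒳.card = 2 ^ j - 1 := by
    rw [h𝒳, Finset.card_erase_of_mem (Finset.mem_powerset.2 le_rfl), Finset.card_powerset, hJ₀card]
  have h𝒳mem : ∀ X ∈ 𝒳, X ⊆ J₀ ∧ X.card < j := by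
    intro X hX
    rw [h𝒳, Finset.mem_erase, Finset.mem_powerset] at hX
    refine ⟨hX.2, ?_⟩
    rw [← hJ₀card]
    exact Finset.card_lt_card (Finset.ssubset_iff_subset_ne.2 ⟨hX.2, hX.1⟩)
  -- the big sets `T_X = S ∪ (D₀ ∖ X)`
  let T : Finset α → Set α := fun X => S ∪ ((D₀ \ X : Finset α) : Set α)
  have hWD : ∀ X, ((D₀ \ X : Finset α) : Set α) ⊆ D := by
    intro X x hx
    rw [Finset.mem_coe, Finset.mem_sdiff] at hx
    exact hDfD x (hD₀D hx.1)
  have hWcl : ∀ X, Disjoint ((D₀ \ X : Finset α) : Set α) (M.closure S) :=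
    fun X => Set.disjoint_left.2 (fun x hx hxc => (hWD X hx).2 hxc)
  have hWS : ∀ X, Disjoint S ((D₀ \ X : Finset α) : Set α) :=
    fun X => Set.disjoint_left.2 (fun x hxS hxW => (hWD X hxW).2 (M.subset_closure S hSE hxS))
  have hWcard : ∀ X ∈ 𝒳, (D₀ \ X).card = k - 1 - X.card := by
    intro X hX
    rw [Finset.card_sdiff_of_subset ((h𝒳mem X hX).1.trans hJ₀D₀), hD₀card]
  have hTbig : ∀ X ∈ 𝒳, T X ∈ bigY M p q := by
    intro X hX
    have hWne : ((D₀ \ X : Finset α) : Set α).Nonempty := by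
      rw [Finset.coe_nonempty, ← Finset.card_pos, hWcard X hX]
      have := (h𝒳mem X hX).2
      omega
    have hWE : ((D₀ \ X : Finset α) : Set α) ⊆ M.E := fun x hx => (hWD X hx).1
    have hTE : T X ⊆ M.E := Set.union_subset hSE hWE
    have hTcard : (T X).ncard = q + j + (k - 1 - X.card) := by
      show (S ∪ ((D₀ \ X : Finset α) : Set α)).ncard = _
      rw [Set.ncard_union_eq (hWS X) hSfin (Finset.finite_toSet _), hj, Set.ncard_coe_finset, hWcard X hX]
    have hgt : (q : ℕ∞) < M.eRk (T X) := by
      have hne : M.eRk (T X) ≠ M.eRk S := by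
        intro h
        have := (eRk_union_eq_iff_subset_closure M hSE hWE).1 h
        obtain ⟨x, hx⟩ := hWne
        exact Set.disjoint_left.1 (hWcl X) hx (this hx)
      have hle : M.eRk S ≤ M.eRk (T X) := M.eRk_mono Set.subset_union_left
      rw [hqS] at hne hle
      exact lt_of_le_of_ne hle (Ne.symm hne)
    have hlt : M.eRk (T X) < (p : ℕ∞) := by
      have h1 : M.eRk (T X) ≤ M.eRk S + ((D₀ \ X : Finset α) : Set α).encard :=
        M.eRk_union_le_eRk_add_encard S _
      rw [hqS, (Finset.finite_toSet _).cast_ncard_eq.symm, Set.ncard_coe_finset, hWcard X hX] at h1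
      calc M.eRk (T X) ≤ ((q : ℕ) : ℕ∞) + ((k - 1 - X.card : ℕ) : ℕ∞) := h1
        _ = ((q + (k - 1 - X.card) : ℕ) : ℕ∞) := by push_cast; rfl
        _ < (p : ℕ∞) := by exact_mod_cast (show q + (k - 1 - X.card) < p by omega)
    refine ⟨⟨hTE, hgt, hlt⟩, ?_⟩
    rw [hTcard]
    have := (h𝒳mem X hX).2
    omega
  have hTinj : Set.InjOn T 𝒳 := by
    intro X hX Y hY hXY
    have hX' : X ⊆ D₀ := (h𝒳mem X hX).1.trans hJ₀D₀
    have hY' : Y ⊆ D₀ := (h𝒳mem Y hY).1.trans hJ₀D₀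
    have h1 : ∀ X : Finset α, (T X) \ S = ((D₀ \ X : Finset α) : Set α) := by
      intro X
      show (S ∪ ((D₀ \ X : Finset α) : Set α)) \ S = _
      rw [Set.union_sdiff_left, sdiff_eq_left.2 (hWS X).symm]
    have h2 : ((D₀ \ X : Finset α) : Set α) = ((D₀ \ Y : Finset α) : Set α) := by
      rw [← h1 X, ← h1 Y, hXY]
    have h3 : D₀ \ X = D₀ \ Y := Finset.coe_injective h2
    rw [← Finset.sdiff_sdiff_eq_self hX', ← Finset.sdiff_sdiff_eq_self hY', h3]
  -- the mass of each `T_X` is at most `C(q+j, q)·(2^j − 1)` and positive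
  have hC : (0 : ℚ) < ((q + j).choose q : ℚ) := by exact_mod_cast Nat.choose_pos (by omega)
  have hmass : ∀ X ∈ 𝒳, lostMass M p q (T X) ≤ ((q + j).choose q : ℚ) * ((2 : ℚ) ^ j - 1) := by
    intro X hX
    have := lostMass_le_of_isolated M p q hSlost hiso (hWcl X)
    rwa [hj, show q + j - q = j by omega] at this
  have hmasspos : ∀ X ∈ 𝒳, 0 < lostMass M p q (T X) := by
    intro X hX
    unfold lostMass
    have hmem : S ∈ (lostSets_finite M p q).toFinset := by
      rw [(lostSets_finite M p q).mem_toFinset]; exact hSlost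
    refine lt_of_lt_of_le ?_ (Finset.single_le_sum (fun S' _ => ?_) hmem)
    · rw [if_pos (show S ⊆ T X from Set.subset_union_left), hj]
      exact_mod_cast Nat.choose_pos (by omega)
    · split_ifs <;> positivity
  -- each `T_X` pays `S` at least `1/(2^j − 1)`
  have h2j : (0 : ℚ) < (2 : ℚ) ^ j - 1 := by
    have : (2 : ℚ) ^ 1 ≤ (2 : ℚ) ^ j := pow_le_pow_right₀ (by norm_num) hj1
    linarith
  have hpay : ∀ X ∈ 𝒳, 1 / ((2 : ℚ) ^ j - 1) ≤ lostBinWeight M p q S (T X) := by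
    intro X hX
    unfold lostBinWeight
    rw [if_pos ⟨hSlost, hTbig X hX, Set.subset_union_left⟩, hj]
    calc 1 / ((2 : ℚ) ^ j - 1) = ((q + j).choose q : ℚ) / (((q + j).choose q : ℚ) * ((2 : ℚ) ^ j - 1)) := by
          rw [div_mul_eq_div_div, div_self hC.ne']
      _ ≤ ((q + j).choose q : ℚ) / lostMass M p q (T X) :=
          div_le_div_of_nonneg_left hC.le (hmasspos X hX) (hmass X hX)
  -- sum over the family
  have hsub : 𝒳.image T ⊆ (bigY_finite M p q).toFinset := by
    intro T' hT'
    rw [Finset.mem_image] at hT'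
    obtain ⟨X, hX, rfl⟩ := hT'
    rw [(bigY_finite M p q).mem_toFinset]
    exact hTbig X hX
  calc (1 : ℚ) = (𝒳.card : ℚ) * (1 / ((2 : ℚ) ^ j - 1)) := by
        rw [h𝒳card, Nat.cast_sub (Nat.one_le_two_pow), Nat.cast_pow, Nat.cast_ofNat, Nat.cast_one,
          mul_one_div, div_self h2j.ne']
    _ = ∑ X ∈ 𝒳, 1 / ((2 : ℚ) ^ j - 1) := by rw [Finset.sum_const, nsmul_eq_mul]
    _ ≤ ∑ X ∈ 𝒳, lostBinWeight M p q S (T X) := Finset.sum_le_sum hpay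
    _ = ∑ T' ∈ 𝒳.image T, lostBinWeight M p q S T' := (Finset.sum_image hTinj).symm
    _ ≤ ∑ T' ∈ (bigY_finite M p q).toFinset, lostBinWeight M p q S T' :=
        Finset.sum_le_sum_of_subset_of_nonneg hsub (fun T' _ _ => lostBinWeight_nonneg M p q S T')
    _ = lostBinRecv M p q S := rfl

/-- **Rule BIN pays every lost set when all of them are isolated** — the single-flat class. -/
theorem lostBin_of_forall_isolated (p q : ℕ) (hE : M.E.ncard = p + q) (hpq : q < p)
    (h : ∀ S ∈ lostSets M p q, IsolatedLost M p q S) : LostBin M p q :=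
  fun S hS => one_le_lostBinRecv_of_isolated M p q hE hpq hS (h S hS)

/-- **The UP-Hall form of C-044 at the tight layer when every lost set is isolated.** -/
theorem hallUp_of_ncard_eq_of_forall_isolated (p q : ℕ) (hE : M.E.ncard = p + q) (hpq : q < p)
    (h : ∀ S ∈ lostSets M p q, IsolatedLost M p q S) (𝒜 : Set (Set α)) (h𝒜 : 𝒜 ⊆ cellMembers M p q) :
    phiK p q * (𝒜.ncard : ℚ) ≤ ((upNbhd M p q 𝒜).ncard : ℚ) :=
  hallUp_of_ncard_eq_of_lostBin M p q hE hpq (lostBin_of_forall_isolated M p q hE hpq h) 𝒜 h𝒜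

end PercRepro
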